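import Summits.RiemannHypothesis.RiemannHypothesis.Theorems.PfPersistenceFfAngleTwin

/-!
# Function-field mirror: the GRAM REPRESENTATION of the window tower on RH-true data —
positivity of every window, definiteness of the informative windows, and the kernel at `M ≥ 2g`
(pub-rhpf, seat ffmirror-2 gen 4; HONEST FRAMING: mechanism/rigidity campaign — no RH claims)

Setting of `PfPersistenceFfAngleTwin` (pub-weilobs `FF.md` §1): a datum `(q, A)`, `A` the multiset of
Frobenius roots (`#A = 2g`), normalised roots `U = A/√q`, Toeplitz symbol `K(n) = ½ Σ_{u ∈ U} u^n` and
window forms `T_M = (K(|m - m'|))_{0 ≤ m,m' ≤ M}` (`ffWindowForm q A M`; `weilWindowForm q h M` for the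
characteristic polynomial of Frobenius `h ∈ ℤ[x]`).

This file proves, by pure algebra ([folklore]; the classical Carathéodory–Toeplitz picture of a finitely
atomic measure on the circle), what the window tower IS when the datum satisfies the function-field
Riemann hypothesis `|α| = √q` for every root (`U` unimodular) and is real (`U` closed under complex
conjugation — automatic for `h ∈ ℤ[x]`, `frobRoots_map_conj`):

* GRAM REPRESENTATION `ffWindowForm_eq_gram`: `T_M = W Wᴴ` with the Vandermonde-type factor
  `W_{m,j} = u_j^m / √2` (rows `0 ≤ m ≤ M`, one column per root), for EVERY window `M`.  Hence
* POSITIVITY `ffWindowForm_posSemidef` / `weilWindowForm_posSemidef`: every window form of an RH-true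
  datum is positive semidefinite (the direction "RH ⇒ Weil positivity" of the function-field explicit
  formula, window by window; no converse is claimed here);
* DEFINITENESS OF THE INFORMATIVE WINDOWS `ffWindowForm_posDef`: if the normalised roots are pairwise
  distinct and `M + 1 ≤ 2g`, `T_M` is positive definite (`ε₁(T_M) > 0`);
* THE KERNEL FROM `M = 2g` ON `ffWindowForm_mulVec_rootPoly_eq_zero` / `weilWindowForm_mulVec_coeff_eq_zero`
  / `…_det_eq_zero`: for `M ≥ 2g` the coefficient vectors of `z^j · ∏_{u ∈ U} (z - u)`, `j ≤ M - 2g`, lie in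
  the kernel of `T_M`; for the datum `(q, h)` the vector `(h_m (√q)^m)_{0 ≤ m ≤ M}` of rescaled integer
  coefficients of `h` does.  So `det T_M = 0`: `ε₁(T_M) = 0` carries no information beyond `M = 2g - 1`,
  and (informal reading of the two theorems together: for pairwise distinct roots `T_{2g-1} ≻ 0`, so the
  kernel of `T_{2g}` is the line spanned by that coefficient vector) the window `M = 2g` hands an
  eigenvector reader the normalised Frobenius polynomial itself — at that depth "lattice resolution" is
  free, and what then separates an honest fake from a genuine zeta function is a function of `(q, h)`
  (Honda–Tate, cited in `PfPersistenceFfAngleTwin`, not formalised), i.e. the arithmetic door E-MOT of the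
  cell's ledger, not a spectral quantity of the window data.

Cell bookkeeping: this makes the clause "from `M = 2g` on every RH-true form is singular (rank `T_M ≤ 2g`)"
of HOME/pub-rhpf-ffmirror-2/SEPARATION.md §12.1 (there DERIVED) a kernel fact, and records the RH-true half
of the seat's separation table (populations GJ/GA/H: all windows PSD) as PROVED.  Nothing here is a
statement about ζ; no RH claim in either direction.
-/

set_option linter.dupNamespace false  -- the mandated namespace repeats `RiemannHypothesis`

noncomputable section

open Polynomial Matrix Finset
open scoped ComplexOrder ComplexConjugate

namespace Summit.RiemannHypothesis.RiemannHypothesis.Theorems.PfPersistence.FfAngleTwin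

/-! ## Enumerating a multiset -/

/-- Every multiset is the multiset of values of a function on `Fin k`. [folklore] -/
theorem exists_eq_univ_val_map (s : Multiset ℂ) :
    ∃ (k : ℕ) (u : Fin k → ℂ), (univ : Finset (Fin k)).val.map u = s := by
  induction s using Quotient.inductionOn with
  | h l => exact ⟨l.length, l.get, by rw [Fin.univ_val_map, List.ofFn_get]; rfl⟩

variable {ι : Type*} [Fintype ι]

/-- The values of an enumeration lie in the enumerated multiset. [folklore] -/
theorem mem_of_univ_val_map {u : ι → ℂ} {s : Multiset ℂ} (hU : univ.val.map u = s) (i : ι) :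
    u i ∈ s := by
  rw [← hU]; exact Multiset.mem_map.2 ⟨i, Finset.mem_univ_val i, rfl⟩

/-- A sum over an enumeration is the corresponding multiset sum. [folklore] -/
theorem sum_univ_eq_multiset_sum {u : ι → ℂ} {s : Multiset ℂ} (hU : univ.val.map u = s)
    (f : ℂ → ℂ) : ∑ i, f (u i) = (s.map f).sum := by
  rw [Finset.sum_eq_multiset_sum, ← hU, Multiset.map_map]; rfl

/-- An enumeration of a multiset without repetitions is injective. [folklore] -/
theorem injective_of_univ_val_map {u : ι → ℂ} {s : Multiset ℂ} (hU : univ.val.map u = s)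
    (hs : s.Nodup) : Function.Injective u := by
  rw [← hU] at hs
  intro i j hij
  exact (Multiset.nodup_map_iff_inj_on univ.nodup).1 hs i (mem_univ i) j (mem_univ j) hij

/-- The enumerating type has the cardinality of the multiset. [folklore] -/
theorem card_eq_of_univ_val_map {u : ι → ℂ} {s : Multiset ℂ} (hU : univ.val.map u = s) :
    Fintype.card ι = Multiset.card s := by
  rw [← hU, Multiset.card_map, Finset.card_val, Finset.card_univ]

/-! ## The Gram (Vandermonde) factor -/

-- The Gram (Vandermonde-type) factor of a root family `u : ι → ℂ` at window `M` is the
-- `(M + 1) × ι` matrix `W(u, M)_{r,j} = u_j^r / √2` (rows `r = 0, …, M`), written inline below as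
-- `Matrix.of fun (r : Fin (M + 1)) (j : ι) => u j ^ (r : ℕ) / (Real.sqrt 2 : ℂ)` (no new declaration;
-- a named `def` would only rename this one-liner).

/-- Entries of `W Wᴴ`: `(W Wᴴ)_{m,m'} = ½ Σ_j u_j^m · conj(u_j)^{m'}`. [folklore] -/
theorem gram_mul_conjTranspose_apply (u : ι → ℂ) (M : ℕ) (m m' : Fin (M + 1)) :
    ((Matrix.of fun (r : Fin (M + 1)) (j : ι) => u j ^ (r : ℕ) / (Real.sqrt 2 : ℂ)) *
      (Matrix.of fun (r : Fin (M + 1)) (j : ι) => u j ^ (r : ℕ) / (Real.sqrt 2 : ℂ))ᴴ) m m' =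
      (∑ i, u i ^ (m : ℕ) * conj (u i) ^ (m' : ℕ)) / 2 := by
  have h2 : (Real.sqrt 2 : ℂ) * (Real.sqrt 2 : ℂ) = 2 := by
    rw [← Complex.ofReal_mul, Real.mul_self_sqrt (by norm_num : (0:ℝ) ≤ 2)]; norm_num
  simp only [Matrix.mul_apply, Matrix.conjTranspose_apply, Matrix.of_apply,
    Complex.star_def, map_div₀, map_pow, Complex.conj_ofReal, div_mul_div_comm, h2, Finset.sum_div]

omit [Fintype ι] in
/-- `Wᴴ` applied to a coefficient vector evaluates the polynomial at the conjugate roots: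
`(Wᴴ c)_j = (Σ_m c_m conj(u_j)^m) / √2`. [folklore] -/
theorem gram_conjTranspose_mulVec (u : ι → ℂ) (M : ℕ) (c : Fin (M + 1) → ℂ) (i : ι) :
    ((Matrix.of fun (r : Fin (M + 1)) (j : ι) => u j ^ (r : ℕ) / (Real.sqrt 2 : ℂ))ᴴ *ᵥ c) i =
      (∑ m : Fin (M + 1), c m * conj (u i) ^ (m : ℕ)) / (Real.sqrt 2 : ℂ) := by
  simp only [Matrix.mulVec, dotProduct, Matrix.conjTranspose_apply, Matrix.of_apply,
    Complex.star_def, map_div₀, map_pow, Complex.conj_ofReal, Finset.sum_div]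
  exact Finset.sum_congr rfl fun m _ => by ring

/-- `W Wᴴ` kills every vector that `Wᴴ` kills. [folklore] -/
theorem gram_mulVec_eq_zero_of_sum_eq_zero {u : ι → ℂ} {M : ℕ} {c : Fin (M + 1) → ℂ}
    (h : ∀ i, ∑ m : Fin (M + 1), c m * conj (u i) ^ (m : ℕ) = 0) :
    ((Matrix.of fun (r : Fin (M + 1)) (j : ι) => u j ^ (r : ℕ) / (Real.sqrt 2 : ℂ)) *
      (Matrix.of fun (r : Fin (M + 1)) (j : ι) => u j ^ (r : ℕ) / (Real.sqrt 2 : ℂ))ᴴ) *ᵥ c = 0 := by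
  rw [← Matrix.mulVec_mulVec]
  have h0 :
      (Matrix.of fun (r : Fin (M + 1)) (j : ι) => u j ^ (r : ℕ) / (Real.sqrt 2 : ℂ))ᴴ *ᵥ c = 0 := by
    ext i; simp only [gram_conjTranspose_mulVec, h i, zero_div, Pi.zero_apply]
  rw [h0, Matrix.mulVec_zero]

/-! ## Unimodular moments -/

/-- `u^m conj(u)^{m'} = u^{m-m'}` for `|u| = 1`, `m' ≤ m`. [folklore] -/
theorem pow_mul_conj_pow_of_le {u : ℂ} (hu : ‖u‖ = 1) {m m' : ℕ} (h : m' ≤ m) :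
    u ^ m * conj u ^ m' = u ^ (m - m') := by
  have h1 : u * conj u = 1 := by
    rw [Complex.mul_conj, Complex.normSq_eq_norm_sq, hu, one_pow, Complex.ofReal_one]
  obtain ⟨d, rfl⟩ := Nat.exists_eq_add_of_le h
  rw [Nat.add_sub_cancel_left, pow_add, mul_right_comm, ← mul_pow, h1, one_pow, one_mul]

/-- `u^m conj(u)^{m'} = conj(u)^{m'-m}` for `|u| = 1`, `m ≤ m'`. [folklore] -/
theorem pow_mul_conj_pow_of_ge {u : ℂ} (hu : ‖u‖ = 1) {m m' : ℕ} (h : m ≤ m') :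
    u ^ m * conj u ^ m' = conj u ^ (m' - m) := by
  have h1 : u * conj u = 1 := by
    rw [Complex.mul_conj, Complex.normSq_eq_norm_sq, hu, one_pow, Complex.ofReal_one]
  obtain ⟨d, rfl⟩ := Nat.exists_eq_add_of_le h
  rw [Nat.add_sub_cancel_left, pow_add, ← mul_assoc, ← mul_pow, h1, one_pow, one_mul]

/-- MOMENT IDENTITY: for a unimodular, conjugation-closed multiset `U` enumerated by `u`,
`Σ_j u_j^m conj(u_j)^{m'} = s_{|m-m'|}(U)`. [folklore] -/
theorem sum_pow_mul_conj_pow {u : ι → ℂ} {U : Multiset ℂ} (hU : univ.val.map u = U)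
    (hmod : ∀ z ∈ U, ‖z‖ = 1) (hconj : U.map conj = U) (m m' : ℕ) :
    ∑ i, u i ^ m * conj (u i) ^ m' = powerSum U (Nat.dist m m') := by
  have hmod' : ∀ i, ‖u i‖ = 1 := fun i => hmod _ (mem_of_univ_val_map hU i)
  unfold powerSum
  rcases le_total m' m with h | h
  · have key : ∀ i, u i ^ m * conj (u i) ^ m' = u i ^ (m - m') :=
      fun i => pow_mul_conj_pow_of_le (hmod' i) h
    simp_rw [key]
    rw [Nat.dist_eq_sub_of_le_right h]
    exact sum_univ_eq_multiset_sum hU (fun z => z ^ (m - m'))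
  · have key : ∀ i, u i ^ m * conj (u i) ^ m' = conj (u i) ^ (m' - m) :=
      fun i => pow_mul_conj_pow_of_ge (hmod' i) h
    simp_rw [key]
    rw [Nat.dist_eq_sub_of_le h]
    calc ∑ i, conj (u i) ^ (m' - m) = (U.map fun z => conj z ^ (m' - m)).sum :=
          sum_univ_eq_multiset_sum hU (fun z => conj z ^ (m' - m))
      _ = ((U.map conj).map fun z => z ^ (m' - m)).sum := by rw [Multiset.map_map]; rfl
      _ = (U.map fun z => z ^ (m' - m)).sum := by rw [hconj]

/-! ## The Gram representation and positivity of every window -/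

/-- GRAM REPRESENTATION: on a datum whose normalised roots are unimodular (function-field RH) and
conjugation-closed, every window form factors as `T_M = W Wᴴ`. [folklore] -/
theorem ffWindowForm_eq_gram {q : ℝ} {A : Multiset ℂ} {u : ι → ℂ}
    (hU : univ.val.map u = normRoots q A) (hmod : ∀ z ∈ normRoots q A, ‖z‖ = 1)
    (hconj : (normRoots q A).map conj = normRoots q A) (M : ℕ) :
    ffWindowForm q A M =
      (Matrix.of fun (r : Fin (M + 1)) (j : ι) => u j ^ (r : ℕ) / (Real.sqrt 2 : ℂ)) *
        (Matrix.of fun (r : Fin (M + 1)) (j : ι) => u j ^ (r : ℕ) / (Real.sqrt 2 : ℂ))ᴴ := by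
  ext m m'
  rw [gram_mul_conjTranspose_apply, sum_pow_mul_conj_pow hU hmod hconj]
  rfl

/-- POSITIVITY ("RH ⇒ window positivity", every window): `T_M(q, A) ⪰ 0` for all `M`. [folklore] -/
theorem ffWindowForm_posSemidef {q : ℝ} {A : Multiset ℂ} (hmod : ∀ z ∈ normRoots q A, ‖z‖ = 1)
    (hconj : (normRoots q A).map conj = normRoots q A) (M : ℕ) :
    (ffWindowForm q A M).PosSemidef := by
  obtain ⟨k, u, hU⟩ := exists_eq_univ_val_map (normRoots q A)
  rw [ffWindowForm_eq_gram hU hmod hconj M]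
  exact Matrix.posSemidef_self_mul_conjTranspose _

/-! ## Definiteness of the informative windows `M + 1 ≤ 2g` -/

/-- The Gram factor has injective `vecMul` when the roots are distinct and at least `M + 1` in number
(a nonzero polynomial of degree `≤ M` cannot vanish at `M + 1` points). [folklore] -/
theorem gram_vecMul_injective {u : ι → ℂ} (hinj : Function.Injective u) {M : ℕ}
    (hM : M + 1 ≤ Fintype.card ι) :
    Function.Injective (Matrix.of fun (r : Fin (M + 1)) (j : ι) => u j ^ (r : ℕ) / (Real.sqrt 2 : ℂ)).vecMul := by
  have hs2 : (Real.sqrt 2 : ℂ) ≠ 0 := by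
    exact_mod_cast (Real.sqrt_pos.2 (by norm_num : (0:ℝ) < 2)).ne'
  intro x y hxy
  rw [← sub_eq_zero]
  set d : Fin (M + 1) → ℂ := x - y with hd
  have hd0 :
      d ᵥ* (Matrix.of fun (r : Fin (M + 1)) (j : ι) => u j ^ (r : ℕ) / (Real.sqrt 2 : ℂ)) = 0 := by
    rw [hd, Matrix.sub_vecMul]; exact sub_eq_zero.2 hxy
  set r : ℂ[X] := ∑ m : Fin (M + 1), C (d m) * X ^ (m : ℕ) with hr
  have hdeg : r.natDegree ≤ M :=
    natDegree_sum_le_of_forall_le _ _ fun m _ =>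
      (natDegree_C_mul_X_pow_le (d m) m).trans (Nat.lt_succ_iff.1 m.isLt)
  have heval : ∀ i, r.eval (u i) = 0 := by
    intro i
    have hi := congr_fun hd0 i
    simp only [Matrix.vecMul, dotProduct, Matrix.of_apply, Pi.zero_apply] at hi
    have hi' : (∑ m : Fin (M + 1), d m * u i ^ (m : ℕ)) / (Real.sqrt 2 : ℂ) = 0 := by
      rw [Finset.sum_div]
      refine (Finset.sum_congr rfl fun m _ => ?_).trans hi
      ring
    rw [div_eq_zero_iff] at hi'
    rcases hi' with hi' | hi'
    · rw [hr, eval_finsetSum]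
      simpa only [eval_mul, eval_C, eval_pow, eval_X] using hi'
    · exact absurd hi' hs2
  have hr0 : r = 0 :=
    eq_zero_of_natDegree_lt_card_of_eval_eq_zero r hinj heval (by omega)
  funext m
  have hm : r.coeff m = d m := by
    rw [hr, finsetSum_coeff]
    simp only [coeff_C_mul_X_pow]
    rw [Finset.sum_eq_single m]
    · simp
    · intro b _ hb
      rw [if_neg]
      exact fun h => hb (Fin.ext h.symm)
    · intro h; exact absurd (mem_univ m) h
  rw [← hm, hr0, coeff_zero, Pi.zero_apply]

/-- DEFINITENESS OF THE INFORMATIVE WINDOWS: if the normalised roots are unimodular, conjugation-closed and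
pairwise DISTINCT, then `T_M ≻ 0` for `M + 1 ≤ #A` (`= 2g`), i.e. `ε₁(T_M) > 0`. [folklore] -/
theorem ffWindowForm_posDef {q : ℝ} {A : Multiset ℂ} (hmod : ∀ z ∈ normRoots q A, ‖z‖ = 1)
    (hconj : (normRoots q A).map conj = normRoots q A) (hnodup : (normRoots q A).Nodup)
    {M : ℕ} (hM : M + 1 ≤ Multiset.card A) : (ffWindowForm q A M).PosDef := by
  obtain ⟨k, u, hU⟩ := exists_eq_univ_val_map (normRoots q A)
  rw [ffWindowForm_eq_gram hU hmod hconj M]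
  refine Matrix.PosDef.mul_conjTranspose_self _ (gram_vecMul_injective
    (injective_of_univ_val_map hU hnodup) ?_)
  rw [card_eq_of_univ_val_map hU, card_normRoots]; exact hM

/-! ## The kernel from `M = 2g` on -/

/-- A finite coefficient sum is a polynomial evaluation. [folklore] -/
theorem sum_fin_coeff_mul_pow {p : ℂ[X]} {M : ℕ} (hp : p.natDegree ≤ M) (z : ℂ) :
    ∑ m : Fin (M + 1), p.coeff m * z ^ (m : ℕ) = p.eval z := by
  rw [eval_eq_sum_range' (Nat.lt_succ_of_le hp), ← Fin.sum_univ_eq_sum_range]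

/-- The root polynomial `∏_{w ∈ U} (z - w)` vanishes on `U`. [folklore] -/
theorem eval_rootPoly_eq_zero {U : Multiset ℂ} {z : ℂ} (hz : z ∈ U) :
    ((U.map fun w => X - C w).prod).eval z = 0 := by
  have hp : (U.map fun w => X - C w).prod ≠ 0 :=
    (monic_multiset_prod_of_monic _ _ fun w _ => monic_X_sub_C w).ne_zero
  have hmem : z ∈ ((U.map fun w => X - C w).prod).roots := by rwa [roots_multiset_prod_X_sub_C]
  exact (mem_roots hp).1 hmem

/-- KERNEL FAMILY: for `M ≥ #A + j`, the coefficient vector of `z^j · ∏_{u ∈ U}(z - u)` (`U = A/√q`) is in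
the kernel of `T_M(q, A)`. [folklore] -/
theorem ffWindowForm_mulVec_rootPoly_eq_zero {q : ℝ} {A : Multiset ℂ}
    (hmod : ∀ z ∈ normRoots q A, ‖z‖ = 1) (hconj : (normRoots q A).map conj = normRoots q A)
    {M j : ℕ} (hM : Multiset.card A + j ≤ M) :
    ffWindowForm q A M *ᵥ
      (fun m => (X ^ j * ((normRoots q A).map fun w => X - C w).prod).coeff m) = 0 := by
  obtain ⟨k, u, hU⟩ := exists_eq_univ_val_map (normRoots q A)
  rw [ffWindowForm_eq_gram hU hmod hconj M]
  set p : ℂ[X] := ((normRoots q A).map fun w => X - C w).prod with hp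
  have hdeg : (X ^ j * p).natDegree ≤ M := by
    calc (X ^ j * p).natDegree ≤ (X ^ j : ℂ[X]).natDegree + p.natDegree := natDegree_mul_le
      _ ≤ j + Multiset.card A := by
          rw [hp, natDegree_multiset_prod_X_sub_C_eq_card, card_normRoots]
          exact add_le_add (natDegree_X_pow_le j) le_rfl
      _ ≤ M := by omega
  refine gram_mulVec_eq_zero_of_sum_eq_zero fun i => ?_
  have hmem : conj (u i) ∈ normRoots q A := by
    rw [← hconj]; exact Multiset.mem_map_of_mem _ (mem_of_univ_val_map hU i)
  rw [sum_fin_coeff_mul_pow hdeg, eval_mul, eval_rootPoly_eq_zero hmem, mul_zero]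

/-- The coefficient vector of `z^j · ∏ (z - u)` is not zero (the polynomial is monic). [folklore] -/
theorem rootPolyCoeff_ne_zero (U : Multiset ℂ) {M j : ℕ} (hM : Multiset.card U + j ≤ M) :
    (fun m : Fin (M + 1) => (X ^ j * (U.map fun w => X - C w).prod).coeff m) ≠ 0 := by
  have hmon : (U.map fun w => X - C w).prod.Monic :=
    monic_multiset_prod_of_monic _ _ fun w _ => monic_X_sub_C w
  have hcoeff : (U.map fun w => X - C w).prod.coeff (Multiset.card U) = 1 := by
    have h1 := hmon.coeff_natDegree; rwa [natDegree_multiset_prod_X_sub_C_eq_card] at h1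
  intro h
  have h1 := congr_fun h ⟨Multiset.card U + j, Nat.lt_succ_of_le hM⟩
  simp only [Pi.zero_apply] at h1
  rw [coeff_X_pow_mul, hcoeff] at h1
  exact one_ne_zero h1

/-- SINGULARITY FROM `M = 2g` ON: `det T_M(q, A) = 0` for `M ≥ #A` on RH-true data. [folklore] -/
theorem ffWindowForm_det_eq_zero {q : ℝ} {A : Multiset ℂ}
    (hmod : ∀ z ∈ normRoots q A, ‖z‖ = 1) (hconj : (normRoots q A).map conj = normRoots q A)
    {M : ℕ} (hM : Multiset.card A ≤ M) : (ffWindowForm q A M).det = 0 := by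
  refine Matrix.exists_mulVec_eq_zero_iff.1 ⟨_, rootPolyCoeff_ne_zero (normRoots q A) (j := 0) ?_,
    ffWindowForm_mulVec_rootPoly_eq_zero hmod hconj (j := 0) (by simpa using hM)⟩
  rw [card_normRoots]; simpa using hM

/-! ## Dictionary with integer polynomials: the datum `(q, h)` -/

/-- The complex roots of an integer polynomial are closed under conjugation. [folklore] -/
theorem frobRoots_map_conj (h : ℤ[X]) : (frobRoots h).map conj = frobRoots h := by
  unfold frobRoots
  rw [roots_map_of_injective_of_card_eq_natDegree (starRingEnd ℂ).injective
      IsAlgClosed.card_roots_eq_natDegree, Polynomial.map_map,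
    RingHom.ext_int ((starRingEnd ℂ).comp (Int.castRingHom ℂ)) (Int.castRingHom ℂ)]

/-- Normalisation commutes with conjugation (`√q` is real). [folklore] -/
theorem normRoots_map_conj (q : ℝ) (A : Multiset ℂ) :
    (normRoots q A).map conj = normRoots q (A.map conj) := by
  unfold normRoots
  rw [Multiset.map_map, Multiset.map_map]
  exact Multiset.map_congr rfl fun α _ => by
    simp only [Function.comp_apply, map_div₀, Complex.conj_ofReal]

/-- The normalised roots of `(q, h)` are conjugation-closed. [folklore] -/
theorem normRoots_frobRoots_map_conj (q : ℝ) (h : ℤ[X]) :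
    (normRoots q (frobRoots h)).map conj = normRoots q (frobRoots h) := by
  rw [normRoots_map_conj, frobRoots_map_conj]

/-- Function-field RH `|α| = √q` for every root ⇒ the normalised roots are unimodular. [folklore] -/
theorem normRoots_norm_eq_one {q : ℝ} (hq : 0 < q) {A : Multiset ℂ}
    (hRH : ∀ α ∈ A, ‖α‖ = Real.sqrt q) : ∀ z ∈ normRoots q A, ‖z‖ = 1 := by
  intro z hz
  obtain ⟨α, hα, rfl⟩ := Multiset.mem_map.1 hz
  have hs : (0:ℝ) < Real.sqrt q := Real.sqrt_pos.2 hq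
  rw [norm_div, hRH α hα, Complex.norm_real, Real.norm_eq_abs, abs_of_pos hs, div_self hs.ne']

/-- `#(roots of h over ℂ) = deg h`. [folklore] -/
theorem card_frobRoots_eq_natDegree (h : ℤ[X]) : Multiset.card (frobRoots h) = h.natDegree := by
  unfold frobRoots
  rw [IsAlgClosed.card_roots_eq_natDegree, natDegree_map_eq_of_injective (Int.castRingHom ℂ).injective_int]

/-- POSITIVITY for `(q, h)`: if every root of `h` has absolute value `√q` (function-field RH), every window
form `T_M(q, h)` is positive semidefinite. [folklore] -/
theorem weilWindowForm_posSemidef {q : ℝ} (hq : 0 < q) {h : ℤ[X]}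
    (hRH : ∀ α ∈ frobRoots h, ‖α‖ = Real.sqrt q) (M : ℕ) : (weilWindowForm q h M).PosSemidef :=
  ffWindowForm_posSemidef (normRoots_norm_eq_one hq hRH) (normRoots_frobRoots_map_conj q h) M

/-- DEFINITENESS for `(q, h)` on the informative windows: RH + pairwise distinct roots + `M + 1 ≤ deg h`
⇒ `T_M(q, h) ≻ 0`. [folklore] -/
theorem weilWindowForm_posDef {q : ℝ} (hq : 0 < q) {h : ℤ[X]}
    (hRH : ∀ α ∈ frobRoots h, ‖α‖ = Real.sqrt q) (hnodup : (frobRoots h).Nodup)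
    {M : ℕ} (hM : M + 1 ≤ h.natDegree) : (weilWindowForm q h M).PosDef := by
  have hs : (Real.sqrt q : ℂ) ≠ 0 := by exact_mod_cast (Real.sqrt_pos.2 hq).ne'
  refine ffWindowForm_posDef (normRoots_norm_eq_one hq hRH) (normRoots_frobRoots_map_conj q h) ?_ ?_
  · exact hnodup.map fun a b hab => (div_left_inj' hs).1 hab
  · rwa [card_frobRoots_eq_natDegree]

/-- SINGULARITY for `(q, h)`: RH + `M ≥ deg h` ⇒ `det T_M(q, h) = 0`. [folklore] -/
theorem weilWindowForm_det_eq_zero {q : ℝ} (hq : 0 < q) {h : ℤ[X]}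
    (hRH : ∀ α ∈ frobRoots h, ‖α‖ = Real.sqrt q) {M : ℕ} (hM : h.natDegree ≤ M) :
    (weilWindowForm q h M).det = 0 :=
  ffWindowForm_det_eq_zero (normRoots_norm_eq_one hq hRH) (normRoots_frobRoots_map_conj q h)
    (by rwa [card_frobRoots_eq_natDegree])

/-- THE WINDOW HANDS OVER THE FROBENIUS POLYNOMIAL: for `M ≥ deg h` the vector of rescaled integer
coefficients `(h_m (√q)^m)_{0 ≤ m ≤ M}` is in the kernel of `T_M(q, h)` (RH-true `h`). [folklore] -/
theorem weilWindowForm_mulVec_coeff_eq_zero {q : ℝ} (hq : 0 < q) {h : ℤ[X]}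
    (hRH : ∀ α ∈ frobRoots h, ‖α‖ = Real.sqrt q) {M : ℕ} (hM : h.natDegree ≤ M) :
    weilWindowForm q h M *ᵥ (fun m => (h.coeff m : ℂ) * (Real.sqrt q : ℂ) ^ (m : ℕ)) = 0 := by
  by_cases hh : h = 0
  · subst hh
    have : (fun m : Fin (M + 1) => ((0 : ℤ[X]).coeff m : ℂ) * (Real.sqrt q : ℂ) ^ (m : ℕ)) = 0 := by
      funext m; simp
    rw [this, Matrix.mulVec_zero]
  obtain ⟨k, u, hU⟩ := exists_eq_univ_val_map (normRoots q (frobRoots h))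
  have hs : (Real.sqrt q : ℂ) ≠ 0 := by exact_mod_cast (Real.sqrt_pos.2 hq).ne'
  set P : ℂ[X] := h.map (Int.castRingHom ℂ) with hP
  have hP0 : P ≠ 0 := fun h0 => hh (Polynomial.map_injective (Int.castRingHom ℂ)
    (Int.castRingHom ℂ).injective_int (by rw [← hP, h0, Polynomial.map_zero]))
  have hdegP : P.natDegree ≤ M := (natDegree_map_le).trans hM
  unfold weilWindowForm
  rw [ffWindowForm_eq_gram hU (normRoots_norm_eq_one hq hRH) (normRoots_frobRoots_map_conj q h) M]
  refine gram_mulVec_eq_zero_of_sum_eq_zero fun i => ?_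
  -- `u i = α / √q` for a root `α`; `√q · conj (u i) = conj α` is again a root.
  obtain ⟨α, hα, hαu⟩ := Multiset.mem_map.1 (mem_of_univ_val_map hU i)
  have hroot : (Real.sqrt q : ℂ) * conj (u i) ∈ frobRoots h := by
    rw [← hαu, map_div₀, Complex.conj_ofReal, mul_comm, div_mul_cancel₀ _ hs, ← frobRoots_map_conj h]
    exact Multiset.mem_map_of_mem _ hα
  have heval : P.eval ((Real.sqrt q : ℂ) * conj (u i)) = 0 := (mem_roots hP0).1 hroot
  have hterm : ∀ m : Fin (M + 1), (h.coeff m : ℂ) * (Real.sqrt q : ℂ) ^ (m : ℕ) * conj (u i) ^ (m : ℕ)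
      = P.coeff m * ((Real.sqrt q : ℂ) * conj (u i)) ^ (m : ℕ) := fun m => by
    rw [hP, Polynomial.coeff_map, eq_intCast, mul_pow, mul_assoc]
  rw [Finset.sum_congr rfl fun m _ => hterm m, sum_fin_coeff_mul_pow hdegP, heval]

end Summit.RiemannHypothesis.RiemannHypothesis.Theorems.PfPersistence.FfAngleTwin

end
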